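import Summits.QuantumFields.YangMills.Theorems.BalabanUVNodesN27AtAdmReadingOfRecord13CoPH
import Summits.QuantumFields.YangMills.Theorems.BalabanUVNodesN18AtRateRecord13CoPHRunTowers
import Summits.QuantumFields.YangMills.Theorems.BalabanUVNodesN16AtRRec13CoPHLeafSlotAT

/-!
# BalabanUVNodes ∕ N27 = binder B5 AT THE RECORD — N27 AT THE ADMISSIBLE `CoPH` READING AT RUN TOWERS `runTowers S′`: N18 IN CLOSED FORM AT THE CREATION STEPS `j ≤ k` ONLY (trigger (t2) of this
# seat: a producer face in a NEW currency at the v1.7 `CoPH` reading).  [I] (0.23)–(0.24): the run of `k` renormalization steps on the `k`-th torus creates the terms of creation steps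
# `j = 1, …, k` and no others; node00-def-W1's `Node00/HistoryRecursionOfRecord` types this as `runTowers S′ k := truncRun k (S′ k)` and dag-n18-d's module `…N18AtRateRecord13CoPHRunTowers`
# (15:48Z) reads N18's Stage-13 statement of record at run towers in CLOSED FORM: `S_N18 (RRec₁₃CoPH(On) 𝔯) ⇔` the (1.18) inequality for the UNTRUNCATED towers `S′ k ∕ S′ (k+1)` at the
# run-A domains of creation step `j ≤ k` only (`s_N18_rRec₁₃CoPH(On)_readingAdm_runTowers_iff_le_of_pin`, under the sign letters `0 ≤ C₅`, `0 ≤ θ₅`) — «the honest display of what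
# the statement at the run towers asks», `k + 1` levels per run length.  THIS FILE: XLIᶜᵒᵖᴴ `…N27AtAdmReadingOfRecord13CoPH` (p545621) §1 ∕ §2 at `S := fun F θ ↦ runTowers (S′ F θ)`
# with that closed form in the N18 slot (XLIᶜᵒᵖᴴ §2's closed form, now with the extra premise `X.1 ≤ k`; §1's stub form unfolded), N22 ⟸ N18 by dag-n22-e 8a″ (analytic ∕ STRIP) at these
# towers, N16 AT-keyed (`LeafSlotAT`, dag-n16-e 39ᴴ).  Every run-tower reading of this lineage (XLIIᶜᵒᵖᴴ, `…GenBelow`, `…TermDatumTowers…`: `S′ := k ↦ toClusterTower (G F θ k)` ∕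
# `… (𝔇 F θ k).Gn₀`) is an instance of `S′`
# (cell `pub-ymgap`, HUMAN RULING D-0062 Track A, R134 seat `pub-ymgap-dag-n27-c` (s2) gen 9; K3⁷ `SpineGivenEndpointR13SepCoPH` = stmt-QuantumFields-20544, `--kind proof --supports 20544 --as helper`;
# COUNT-NEUTRAL; `N`-generic, regime-generic, NO Theses import — the item-facing face is ONE application of leaf A §4 at `Rg := Node00.unityNondeg₁₃H 2`, `N = 2` at the call site)

WHAT IS KERNEL-CHECKED ([bookkeeping]; 0 `def`, 0 `sorry`; each theorem ONE application of XLᶜᵒᵖᴴ `spine_rec13CCoPH(On)_at_readingOfRecord₁₃CoPH` with dag-n18-d's run-tower iff (`.mpr`) in the N18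
slot, dag-n22-e 8a″ eliminating N22 given N18, dag-n16-e 39ᴴ in the N16 slot):
* §1 `spine_rec13CCoPH_at_runTowers₁₃CoPH_le` — CANONICAL HOME ⇒ `Spine ₁₃CCoPH`.
* §2 `spine_rec13CCoPHOn_at_runTowers₁₃CoPH_le` — REGIME HOME, any `Rg` ⇒ `Spine (IsRecordOfRecord₁₃CCoPHOn Rg)`; at `Rg := Node00.unityNondeg₁₃H N` RR-2's CN class.

HONEST FRAMING.  COMPOSITE-node bookkeeping BY NAME: the (1.18) inequality at the creation steps `j ≤ k`, the sign letters, (J) ∕ (A) ∕ STRIP-(1.18), the numerals, NE1′, NE2,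
`InEndRegime ∧ LeafSlotAT`, (D4), NE7b, NE7c, the extraction clause and NE7's core edge are DISPLAYED hypotheses with no producer at the ₁₃ reading today (0∕1); towers `S′`, tables, gauges,
transports, letters are PARAMETERS; nothing of Bałaban's asserted or instantiated; no `Provisos₁₃CoPH` inhabitant claimed (K0⁷ open); N18 ∕ N22 ∕ N27 NOT discharged; K3⁷ NOT claimed; counts
UNMOVED (typed 28∕28 · discharged 5∕27, A 5∕28); one finite four-torus programme at fixed `ε` — NOT ℝ⁴, NOT infinite volume, NOT OS, NOT a mass gap, NOT Clay.  General-`N`.  No decl below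
carries a cite tag.
-/

noncomputable section

namespace Summit.QuantumFields.YangMills.Theorems.BalabanUVNodesN27SpineRecord

open Set Metric
open scoped Matrix.Norms.L2Operator

open Literature.MathematicalPhysics.QuantumFieldTheory.Balaban1983to89
open Literature.MathematicalPhysics.QuantumFieldTheory.Balaban1983to89.T4Continuum
open Literature.MathematicalPhysics.QuantumFieldTheory.Balaban1983to89.T4OutputRate (Carriers Functional NE5 DecayBound Window)
open Literature.MathematicalPhysics.QuantumFieldTheory.Balaban1983to89.TreeLengthTorus (TDom tsys torusTreeLen)
open Literature.MathematicalPhysics.QuantumFieldTheory.Balaban1983to89.T4InputCauchyRateData (StepModel)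
open Literature.MathematicalPhysics.QuantumFieldTheory.Balaban1983to89.B13Resummation (locE)
open Literature.MathematicalPhysics.QuantumFieldTheory.Balaban1983to89.TreeLengthTorusGeometry (TTouch)
open Literature.MathematicalPhysics.QuantumFieldTheory.Balaban1983to89.B12TreeDecay (K₀)
open Summit.QuantumFields.BalabanUV.T4Continuum.Spine.NE5
open YMDAG.N18.HLayer
open YMDAG.N18.W1Reading (s_N18_rRec₁₃CoPH_readingAdm_runTowers_iff_le_of_pin s_N18_rRec₁₃CoPHOn_readingAdm_runTowers_iff_le_of_pin)
open T4ContinuumYM4Torus (ForSmallCouplings)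
open Summit.QuantumFields.BalabanUV.T4Continuum.Spine
open YMDAG.UVSplit
open Node00 (Stage13HParams datumOfRecord₁₃CoPH IsRecordOfRecord₁₃CCoPH IsDatumOfRecord₁₃CCoPH NE3Letters₁₁ NE2Objects₁₁ ne3ConstLayerOfRecord₁₁ MatA ιSU prependCoupling)
open Node00.Sect2 (domCount domSys CPair ofBackgroundC)
open Node00.W1 (ReadingData LevelPairing LetterInputs ClusterTower pairOfRecord functionalC termC box SpRestr AdmBg)
open YMDAG.N22 (s_N22_readingOfRecord₁₃CoPH_ofRecordAdm_of_s_N18_analytic s_N22_readingOfRecord₁₃CoPHOn_ofRecordAdm_of_s_N18_stripBound)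
open Summit.QuantumFields.YangMills.BalabanUVNodes.N16Regime (InEndRegime)
open Summit.QuantumFields.YangMills.BalabanUVNodes.N16LeafSlotAllTorus (LeafSlotAT)
open Summit.QuantumFields.YangMills.BalabanUVNodes.N16AtRRec13CoPHLeafSlotAT (s_N16_rRec₁₃CoPH_of_constLayer_leafSlotAT s_N16_rRec₁₃CoPHOn_ofRecord_of_leafSlotAT)
open Node00.W1 (runTowers)

variable {N : ℕ} [NeZero N] (cr : SpineReading₁₃CoPH N)
  (S' : (F : T4Family) → (θ : Stage13HParams F N) → (k : ℕ) → ClusterTower (F.P k) (MatA N) θ.τ9.M)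
  (sp : (F : T4Family) → (θ : Stage13HParams F N) → (k j : ℕ) → (domSys (F.P k) θ.τ9.M j).Dom → Set (CPair (F.P k) (MatA N)))
  (gauge : (F : T4Family) → (θ : Stage13HParams F N) → (k : ℕ) → GaugeField (F.P k) 0 (Node00.SU N) → GaugeField (F.P k) 0 (Node00.SU N) → ℝ)
  (hg : ∀ (F : T4Family) (θ : Stage13HParams F N) (k : ℕ) (U U' : GaugeField (F.P k) 0 (Node00.SU N)), 0 ≤ gauge F θ k U U')
  (T₀ : (F : T4Family) → (θ : Stage13HParams F N) → (k : ℕ) → GaugeField (F.P (k + 1)) 0 (Node00.SU N) → GaugeField (F.P k) 0 (Node00.SU N))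
  (hT₀ : ∀ (F : T4Family) (θ : Stage13HParams F N) (k : ℕ) (U : GaugeField (F.P (k + 1)) 0 (Node00.SU N)),
    (∀ (j : ℕ) (Y : (domSys (F.P (k + 1)) θ.τ9.M j).Dom), ofBackgroundC (ιSU N) U ∈ sp F θ (k + 1) j Y) →
      ∀ (j : ℕ) (X : (domSys (F.P k) θ.τ9.M j).Dom), ofBackgroundC (ιSU N) (T₀ F θ k U) ∈ sp F θ k j X)
  (li : (F : T4Family) → Stage13HParams F N → LetterInputs) (ℓ₃ : T4Family → NE3Letters₁₁)
  (ne2 : (F : T4Family) → Stage13HParams F N → (ℕ → ℝ) → List (ULoop F) → ℕ → NE2Objects₁₁)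
  (ne1 : (F : T4Family) → Stage13HParams F N → (ℕ → ℝ) → List (ULoop F) → NE1pCarriers)

/-! ## §1 The canonical home of the admissible reading AT RUN TOWERS `runTowers S′` — N18 in closed form at the creation steps `j ≤ k` only -/

section Canonical

/-- ★ **N27 = B5 AT THE STAGE-13 `CoPH` RECORD FROM THE SLOTS AT THE CANONICAL HOME OF THE ADMISSIBLE READING AT THE RUN TOWERS `runTowers S′` — N17 ∕ N22 ELIMINATED, N18 IN CLOSED
FORM AT THE CREATION STEPS `j ≤ k` ONLY** (XLᶜᵒᵖᴴ `spine_rec13CCoPH_at_readingOfRecord₁₃CoPH` at XLIᶜᵒᵖᴴ's admissible reading with towers `runTowers (S′ F θ)` ([I] (0.23)–(0.24): the run of `k`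
steps creates the terms of creation steps `j ≤ k` and no others — node00-def-W1 `Node00/HistoryRecursionOfRecord` `truncRun`); `h18` unfolded by dag-n18-d's
`s_N18_rRec₁₃CoPH_readingAdm_runTowers_iff_le_of_pin` under the sign letters `0 ≤ C₅`, `0 ≤ θ₅`: for every family, datum key `h`, run length `k`, member `b`, history `g`, ADMISSIBLE
run-B field `U` (read inside the table `sp F h.params (k+1)`) and every run-A domain `(j, X)` WITH `j ≤ k`, the (1.18) inequality for the UNTRUNCATED towers `S′ k ∕ S′ (k+1)` —
`k + 1` levels per run length instead of all levels (XLIᶜᵒᵖᴴ §2's closed form)).  N22 ⟸ that N18 by dag-n22-e 8a″ at `S := fun F θ ↦ runTowers (S′ F θ)` ((J), (A), eleven numerals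
VERBATIM); NE1′ ∕ NE2 at `h.params`; N16 as `InEndRegime ∧ LeafSlotAT` (dag-n16-e 39ᴴ); (D4); spine side as XLIᶜᵒᵖᴴ.  Towers `S′`, tables, gauges, transports, letters residual DATA.
Every hypothesis 0∕1 today. [bookkeeping] -/
theorem spine_rec13CCoPH_at_runTowers₁₃CoPH_le
    (hC₅ : ∀ (F : T4Family) (θ : Stage13HParams F N), 0 ≤ (li F θ).C₅) (hθ₅ : ∀ (F : T4Family) (θ : Stage13HParams F N), 0 ≤ (li F θ).θ₅)
    (h14 : ∀ (F : T4Family) (D : Datum F N) (h : IsDatumOfRecord₁₃CCoPH F N D) (g₀ : ℕ → ℝ) (os : List (ULoop F)), N14At (ne1 F h.params g₀ os))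
    (h15 : ∀ (F : T4Family) (D : Datum F N) (h : IsDatumOfRecord₁₃CCoPH F N D) (g₀ : ℕ → ℝ) (os : List (ULoop F)) (k : ℕ),
      N15At (ne2OfRecord₁₁ (ne2 F h.params g₀ os k)))
    (h16 : ∀ (F : T4Family), (∃ D : Datum F N, IsDatumOfRecord₁₃CCoPH F N D) →
      InEndRegime (ne3OfRecord₁₁ F (ne3ConstLayerOfRecord₁₁ F N (ℓ₃ F))) ∧ LeafSlotAT (ne3OfRecord₁₁ F (ne3ConstLayerOfRecord₁₁ F N (ℓ₃ F))))
    -- N18 IN CLOSED FORM AT THE RUN TOWERS: the (1.18) inequality for the UNTRUNCATED towers `S′ k ∕ S′ (k+1)` at the run-A domains of creation step `j ≤ k` ONLY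
    -- (dag-n18-d `s_N18_rRec₁₃CoPH_readingAdm_runTowers_iff_le_of_pin`, RHS verbatim; sign letters `hC₅`, `hθ₅`)
    (h18 : ∀ (F : T4Family) (D : Datum F N) (h : IsDatumOfRecord₁₃CCoPH F N D) (k : ℕ) (b : ℝ), 0 < b → b ≤ h.params.γ →
          ∀ g ∈ Window h.params.γ,
            ∀ (U : {U : GaugeField (F.P (k + 1)) 0 (Node00.SU N) //
                ∀ (j : ℕ) (Y : (domSys (F.P (k + 1)) h.params.τ9.M j).Dom), ofBackgroundC (ιSU N) U ∈ sp F h.params (k + 1) j Y})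
              (X : Node00.W1.Dom (F.P k) h.params.τ9.M), X.1 ≤ k →
            |(functionalC (S' F h.params k) g (ofBackgroundC (ιSU N) (T₀ F h.params k U.1)) X).re -
                (functionalC (S' F h.params (k + 1)) (prependCoupling b g) (ofBackgroundC (ιSU N) U.1) (pairOfRecord F h.params.τ9.M k X)).re| ≤
              (li F h.params).C₅ * (li F h.params).θ₅ ^ X.1 * Real.exp (-((li F h.params).κ * (domSys (F.P k) h.params.τ9.M X.1).dj X.2)))
    -- N22 ⟸ N18 (dag-n22-e module 8a″, analytic sup-letter currency): (J), (A) over ADMISSIBLE run-A fields, eleven numerals — verbatim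
    (hjunk : ∀ (F : T4Family) (θ : Stage13HParams F N), θ.Provisos₁₃CoPH F N → θ.Admissible F N →
      ∀ (k : ℕ) (X : Node00.W1.Dom (F.P k) θ.τ9.M), k < X.1 → ∀ (g : ℕ → ℝ) (φ : CPair (F.P k) (MatA N)), functionalC (runTowers (S' F θ) k) g φ X = 0)
    (hA : ∀ (F : T4Family) (θ : Stage13HParams F N), θ.Provisos₁₃CoPH F N → θ.Admissible F N → ∀ (k : ℕ),
      ∀ g ∈ Window θ.γ, ∀ (U : AdmBg F θ.τ9.M N (sp F θ) k) (X : Node00.W1.Dom (F.P k) θ.τ9.M) (i : ℕ), i < X.1 →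
        ∃ (Fz : ℂ → ℂ) (Dset : Set ℂ), DifferentiableOn ℂ Fz Dset ∧
          (∀ z ∈ Dset, ‖Fz z‖ ≤ (li F θ).A * (li F θ).μ ^ (X.1 - 1 - i) * Real.exp (-((li F θ).κ * (domSys (F.P k) θ.τ9.M X.1).dj X.2))) ∧
          (∀ t ∈ Ioc (0 : ℝ) θ.γ, closedBall (t : ℂ) (li F θ).r ⊆ Dset) ∧
          (∀ t ∈ Ioc (0 : ℝ) θ.γ, Fz t = ((functionalC (runTowers (S' F θ) k) (Function.update g i t) (ofBackgroundC (ιSU N) U.1) X).re : ℂ)))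
    (hnum : ∀ (F : T4Family) (θ : Stage13HParams F N), θ.Provisos₁₃CoPH F N → θ.Admissible F N →
      0 < (li F θ).C₀ ∧ 0 < (li F θ).θ₅ ∧ (li F θ).θ₅ < 1 ∧ 0 ≤ (li F θ).C₅ ∧ 2 * (li F θ).C₅ / (1 - (li F θ).θ₅) ≤ (li F θ).C₀ ∧ 0 < (li F θ).A ∧
        (li F θ).θ₅ ≤ (li F θ).μ ∧ (li F θ).C₀ ≤ 2 * (li F θ).A ∧ 0 < (li F θ).r ∧ 0 < (li F θ).s ∧ (li F θ).s < 1)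
    (hD4 : ∀ (F : T4Family) (D : Datum F N) (h : IsDatumOfRecord₁₃CCoPH F N D) (k : ℕ), ReadOutAt D (u3OfRecord₁₃ h.params.toStage13Params
      ((ReadingData.ofRecordAdm F h.params.τ9.M N (runTowers (S' F h.params)) (sp F h.params) (gauge F h.params) (hg F h.params) (T₀ F h.params) (hT₀ F h.params)
        (li F h.params)).u3Objects h.params.γ) k))
    (hx' : S_N27x (fun F D w => IsRecordOfRecord₁₃CCoPH F N D w) (SRec₁₃CoPH cr)) (h20 : S_N20 (SRec₁₃CoPH cr)) (h21 : S_N21 (SRec₁₃CoPH cr))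
    (h19 : ∀ (F : T4Family) (θ : Stage13HParams F N) (hP : θ.Provisos₁₃CoPH F N), θ.Admissible F N → ∀ (g₀ : ℕ → ℝ) (os : List (ULoop F))
      (h : IsDatumOfRecord₁₃CCoPH F N (datumOfRecord₁₃CoPH F N θ hP)) (k : ℕ),
      RatesAt (datumOfRecord₁₃CoPH F N θ hP) (rateCarriersOfRecord₁₃CoPH (readingOfRecord₁₃CoPH
        (fun F θ => ReadingData.ofRecordAdm F θ.τ9.M N (runTowers (S' F θ)) (sp F θ) (gauge F θ) (hg F θ) (T₀ F θ) (hT₀ F θ) (li F θ)) ℓ₃ ne2 ne1)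
          F h.params h.provisos g₀ os k) → letI := (cr F θ hP g₀ os).dec
        ∃ δ : ℕ → ℝ, NE7.Core (cr F θ hP g₀ os).l₀ (cr F θ hP g₀ os).vol (cr F θ hP g₀ os).T (cr F θ hP g₀ os).Bad
          (fun K t τ => (cr F θ hP g₀ os).A K t τ - (cr F θ hP g₀ os).shA K t τ) (fun K t τ => (cr F θ hP g₀ os).B K t τ - (cr F θ hP g₀ os).shB K t τ) δ ∧
          Summable δ) :
    Spine (N := N) fun F D w => IsRecordOfRecord₁₃CCoPH F N D w :=
  have h18' : S_N18 (RRec₁₃CoPH (readingOfRecord₁₃CoPH (fun F θ => ReadingData.ofRecordAdm F θ.τ9.M N (runTowers (S' F θ)) (sp F θ) (gauge F θ) (hg F θ) (T₀ F θ) (hT₀ F θ) (li F θ)) ℓ₃ ne2 ne1)) :=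
    (s_N18_rRec₁₃CoPH_readingAdm_runTowers_iff_le_of_pin _ S' sp gauge hg T₀ hT₀ li (readingOfRecord₁₃CoPH_u3 _ ℓ₃ ne2 ne1) hC₅ hθ₅).mpr h18
  spine_rec13CCoPH_at_readingOfRecord₁₃CoPH cr _ ℓ₃ ne2 ne1 ((s_N14_readingOfRecord₁₃CoPH_iff _ ℓ₃ ne2 ne1).mpr h14) ((s_N15_readingOfRecord₁₃CoPH_iff _ ℓ₃ ne2 ne1).mpr h15)
    (s_N16_rRec₁₃CoPH_of_constLayer_leafSlotAT (readingOfRecord₁₃CoPH _ ℓ₃ ne2 ne1) (fun F => ne3ConstLayerOfRecord₁₁ F N (ℓ₃ F)) (fun _ _ _ _ _ _ => rfl) h16) h18'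
    (s_N22_readingOfRecord₁₃CoPH_ofRecordAdm_of_s_N18_analytic (fun F θ => runTowers (S' F θ)) sp gauge hg T₀ hT₀ li ℓ₃ ne2 ne1 h18' hjunk hA hnum)
    ((s_D4_readingOfRecord₁₃CoPH_iff _ ℓ₃ ne2 ne1).mpr hD4) hx' h20 h21 h19

end Canonical

/-! ## §2 The regime-restricted home at run towers, any regime `Rg` — N18 in closed form at θ, creation steps `j ≤ k` only -/

section Regime

variable (Rg : (F : T4Family) → Stage13HParams F N → Prop)

/-- ★ **N27 = B5 AT THE REGIME RECORD CLASS `IsRecordOfRecord₁₃CCoPHOn F N Rg` FROM THE SLOTS AT THE REGIME HOME OF THE ADMISSIBLE READING AT RUN TOWERS, ANY `Rg` — N17 ∕ N22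
ELIMINATED, N18 IN CLOSED FORM AT θ AT THE CREATION STEPS `j ≤ k` ONLY** (XLᶜᵒᵖᴴ `spine_rec13CCoPHOn_at_readingOfRecord₁₃CoPH`; `h18` unfolded by dag-n18-d's
`s_N18_rRec₁₃CoPHOn_readingAdm_runTowers_iff_le_of_pin` under the sign letters — XLIᶜᵒᵖᴴ §2's closed form with the extra premise `X.1 ≤ k` (the domains of creation step `j > k` compare
`0` with `0`); N22 ⟸ that N18 by 8a″'s regime STRIP edge at `S := fun F θ ↦ runTowers (S′ F θ)` ((J), twelve numerals, STRIP-(1.18) VERBATIM); NE1′ ∕ NE2 at θ; N16 `LeafSlotAT`; (D4); spine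
side as XXXIXᶜᵒᵖᴴ).  At `Rg := Node00.unityNondeg₁₃H 2`, `N = 2` THE ITEM is leaf A §4 of this.  Every hypothesis 0∕1 today. [bookkeeping] -/
theorem spine_rec13CCoPHOn_at_runTowers₁₃CoPH_le
    (hC₅ : ∀ (F : T4Family) (θ : Stage13HParams F N), 0 ≤ (li F θ).C₅) (hθ₅ : ∀ (F : T4Family) (θ : Stage13HParams F N), 0 ≤ (li F θ).θ₅)
    (h14 : ∀ (F : T4Family) (θ : Stage13HParams F N), θ.Provisos₁₃CoPH F N → Rg F θ → θ.Admissible F N → ∀ (g₀ : ℕ → ℝ) (os : List (ULoop F)),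
      N14At (ne1 F θ g₀ os))
    (h15 : ∀ (F : T4Family) (θ : Stage13HParams F N), θ.Provisos₁₃CoPH F N → Rg F θ → θ.Admissible F N → ∀ (g₀ : ℕ → ℝ) (os : List (ULoop F)) (k : ℕ),
      N15At (ne2OfRecord₁₁ (ne2 F θ g₀ os k)))
    (h16 : ∀ (F : T4Family), (∃ θ : Stage13HParams F N, θ.Provisos₁₃CoPH F N ∧ Rg F θ ∧ θ.Admissible F N) →
      InEndRegime (ne3OfRecord₁₁ F (ne3ConstLayerOfRecord₁₁ F N (ℓ₃ F))) ∧ LeafSlotAT (ne3OfRecord₁₁ F (ne3ConstLayerOfRecord₁₁ F N (ℓ₃ F))))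
    -- N18 IN CLOSED FORM AT θ AT THE RUN TOWERS, creation steps `j ≤ k` only, asked of the tuples IN THE REGIME (dag-n18-d `…CoPHOn…_runTowers_iff_le_of_pin`, RHS verbatim)
    (h18 : ∀ (F : T4Family) (θ : Stage13HParams F N), θ.Provisos₁₃CoPH F N → Rg F θ → θ.Admissible F N → ∀ (k : ℕ) (b : ℝ), 0 < b → b ≤ θ.γ →
          ∀ g ∈ Window θ.γ,
            ∀ (U : {U : GaugeField (F.P (k + 1)) 0 (Node00.SU N) // ∀ (j : ℕ) (Y : (domSys (F.P (k + 1)) θ.τ9.M j).Dom), ofBackgroundC (ιSU N) U ∈ sp F θ (k + 1) j Y})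
              (X : Node00.W1.Dom (F.P k) θ.τ9.M), X.1 ≤ k →
            |(functionalC (S' F θ k) g (ofBackgroundC (ιSU N) (T₀ F θ k U.1)) X).re -
                (functionalC (S' F θ (k + 1)) (prependCoupling b g) (ofBackgroundC (ιSU N) U.1) (pairOfRecord F θ.τ9.M k X)).re| ≤
              (li F θ).C₅ * (li F θ).θ₅ ^ X.1 * Real.exp (-((li F θ).κ * (domSys (F.P k) θ.τ9.M X.1).dj X.2)))
    -- N22 ⟸ N18 (dag-n22-e module 8a″, STRIP currency on the reading's OWN table, NO readings clause): (J), twelve numerals, STRIP-(1.18) — verbatim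
    (hjunk : ∀ (F : T4Family) (θ : Stage13HParams F N), θ.Provisos₁₃CoPH F N → Rg F θ → θ.Admissible F N →
      ∀ (k : ℕ) (X : Node00.W1.Dom (F.P k) θ.τ9.M), k < X.1 → ∀ (g : ℕ → ℝ) (φ : CPair (F.P k) (MatA N)), functionalC (runTowers (S' F θ) k) g φ X = 0)
    (hnum : ∀ (F : T4Family) (θ : Stage13HParams F N), θ.Provisos₁₃CoPH F N → Rg F θ → θ.Admissible F N →
      0 < (li F θ).C₀ ∧ 0 < (li F θ).θ₅ ∧ (li F θ).θ₅ < 1 ∧ 0 ≤ (li F θ).C₅ ∧ 2 * (li F θ).C₅ / (1 - (li F θ).θ₅) ≤ (li F θ).C₀ ∧ 0 < (li F θ).A ∧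
        (li F θ).θ₅ ≤ (li F θ).μ ∧ (li F θ).C₀ ≤ 2 * (li F θ).A ∧ 0 < (li F θ).r ∧ 0 < (li F θ).s ∧ (li F θ).s < 1 ∧ 1 ≤ (li F θ).μ)
    (hstrip : ∀ (F : T4Family) (θ : Stage13HParams F N), θ.Provisos₁₃CoPH F N → Rg F θ → θ.Admissible F N → ∀ (k : ℕ),
      ∀ (j : ℕ) (g : ℕ → ℝ), g ∈ Window θ.γ → ∀ (i : ℕ) (Y : (domSys (F.P k) θ.τ9.M j).Dom) (ψ : CPair (F.P k) (MatA N)), ψ ∈ sp F θ k j Y →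
        ∃ (Ec : ℂ → ℂ) (O : Set ℂ), IsOpen O ∧ (∀ t ∈ Ioc (0 : ℝ) θ.γ, closedBall (t : ℂ) (li F θ).r ⊆ O) ∧ DifferentiableOn ℂ Ec O ∧
          (∀ z ∈ O, ‖Ec z‖ ≤ (li F θ).A * Real.exp (-((li F θ).κ * torusTreeLen Y.1))) ∧
          (∀ t ∈ Ioc (0 : ℝ) θ.γ, Ec t = termC (runTowers (S' F θ) k) j Y (Function.update g i t) ψ))
    (hD4 : ∀ (F : T4Family) (θ : Stage13HParams F N) (hP : θ.Provisos₁₃CoPH F N), Rg F θ → θ.Admissible F N → ∀ k : ℕ,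
      ReadOutAt (datumOfRecord₁₃CoPH F N θ hP) (u3OfRecord₁₃ θ.toStage13Params
        ((ReadingData.ofRecordAdm F θ.τ9.M N (runTowers (S' F θ)) (sp F θ) (gauge F θ) (hg F θ) (T₀ F θ) (hT₀ F θ) (li F θ)).u3Objects θ.γ) k))
    (h20 : S_N20 (SRec₁₃CoPHOn cr Rg)) (h21 : S_N21 (SRec₁₃CoPHOn cr Rg))
    (hx : ∀ (F : T4Family) (θ : Stage13HParams F N) (hP : θ.Provisos₁₃CoPH F N), Rg F θ → θ.Admissible F N →
      B16.EndStatementBPrinted (datumOfRecord₁₃CoPH F N θ hP).C → DagBinding.EndpointExistence (datumOfRecord₁₃CoPH F N θ hP).C.toB12 →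
        ForSmallCouplings (datumOfRecord₁₃CoPH F N θ hP) fun g₀ => ∀ os : List (ULoop F),
          0 < (cr F θ hP g₀ os).l₀ ∧ 0 < (cr F θ hP g₀ os).vol ∧
          (∀ (K : ℕ) (t : ℝ), |t| ≤ (cr F θ hP g₀ os).l₀ →
            T4GenFunBounds.schemeZ ((datumOfRecord₁₃CoPH F N θ hP).scheme g₀) os ((cr F θ hP g₀ os).K₀ + K) t =
              ∑ τ ∈ (cr F θ hP g₀ os).T K, (cr F θ hP g₀ os).A K t τ) ∧
          (∀ (K : ℕ) (t : ℝ), |t| ≤ (cr F θ hP g₀ os).l₀ →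
            T4GenFunBounds.schemeZ ((datumOfRecord₁₃CoPH F N θ hP).scheme g₀) os ((cr F θ hP g₀ os).K₀ + K + 1) t =
              ∑ τ ∈ (cr F θ hP g₀ os).T K, (cr F θ hP g₀ os).B K t τ))
    (h19 : ∀ (F : T4Family) (θ : Stage13HParams F N) (hP : θ.Provisos₁₃CoPH F N), Rg F θ → θ.Admissible F N → ∀ (g₀ : ℕ → ℝ) (os : List (ULoop F)),
      (∀ k : ℕ, RatesAt (datumOfRecord₁₃CoPH F N θ hP) (rateCarriersOfRecord₁₃CoPH (readingOfRecord₁₃CoPH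
        (fun F θ => ReadingData.ofRecordAdm F θ.τ9.M N (runTowers (S' F θ)) (sp F θ) (gauge F θ) (hg F θ) (T₀ F θ) (hT₀ F θ) (li F θ)) ℓ₃ ne2 ne1) F θ hP g₀ os k)) →
        letI := (cr F θ hP g₀ os).dec
        ∃ δ : ℕ → ℝ, NE7.Core (cr F θ hP g₀ os).l₀ (cr F θ hP g₀ os).vol (cr F θ hP g₀ os).T (cr F θ hP g₀ os).Bad
          (fun K t τ => (cr F θ hP g₀ os).A K t τ - (cr F θ hP g₀ os).shA K t τ) (fun K t τ => (cr F θ hP g₀ os).B K t τ - (cr F θ hP g₀ os).shB K t τ) δ ∧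
          Summable δ) :
    Spine (N := N) fun F D w => Node00.IsRecordOfRecord₁₃CCoPHOn F N Rg D w :=
  have h18' : S_N18 (RRec₁₃CoPHOn (readingOfRecord₁₃CoPH (fun F θ => ReadingData.ofRecordAdm F θ.τ9.M N (runTowers (S' F θ)) (sp F θ) (gauge F θ) (hg F θ) (T₀ F θ) (hT₀ F θ) (li F θ)) ℓ₃ ne2 ne1) Rg) :=
    (s_N18_rRec₁₃CoPHOn_readingAdm_runTowers_iff_le_of_pin _ Rg S' sp gauge hg T₀ hT₀ li (readingOfRecord₁₃CoPH_u3 _ ℓ₃ ne2 ne1) hC₅ hθ₅).mpr h18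
  spine_rec13CCoPHOn_at_readingOfRecord₁₃CoPH cr _ ℓ₃ ne2 ne1 Rg
    ((s_N14_rRec₁₃CoPHOn_iff _ Rg).mpr fun F θ hP hRg hθ g₀ os => h14 F θ hP hRg hθ g₀ os)
    ((s_N15_rRec₁₃CoPHOn_iff _ Rg).mpr fun F θ hP hRg hθ g₀ os k => h15 F θ hP hRg hθ g₀ os k)
    (s_N16_rRec₁₃CoPHOn_ofRecord_of_leafSlotAT (readingOfRecord₁₃CoPH _ ℓ₃ ne2 ne1) Rg ℓ₃ (fun _ _ _ _ _ _ => rfl) h16)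
    h18' (s_N22_readingOfRecord₁₃CoPHOn_ofRecordAdm_of_s_N18_stripBound (fun F θ => runTowers (S' F θ)) sp gauge hg T₀ hT₀ li ℓ₃ ne2 ne1 Rg h18' hjunk hnum hstrip)
    ((s_D4_rRec₁₃CoPHOn_iff _ Rg).mpr fun F θ hP hRg hθ _ _ k => hD4 F θ hP hRg hθ k) h20 h21 hx h19

end Regime

end Summit.QuantumFields.YangMills.Theorems.BalabanUVNodesN27SpineRecord

end
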